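import Summits.ResolutionOfSingularities.ResolutionOfSingularities.Theorems.RisoStrataRisoCentresResolveAdjoinIndeterminate
import Summits.ResolutionOfSingularities.ResolutionOfSingularities.Theorems.RisoStrataRisoCentresResolveTranscX2
import Summits.ResolutionOfSingularities.ResolutionOfSingularities.Theorems.RisoStrataRisoCentresResolveToricTVertexInst

/-!
# Crux `RisoCentresResolve` (stmt-ResolutionOfSingularities-18546), line `Sketch`:
# typed `Rtd = 1` along the singular curves of the toric fourfold `T`
# (stub `toricT_curve_rtd_one`)

Lead c2. `T = Spec k[S_T]`, `B = k[S_T] = Algebra.adjoin k (range GK) ⊆ K = k(t₀,…,t₃)` as in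
`toricT_vertex_not_rtd_one`. At a point `t₂ = c ≠ 0` of the singular curve `C₃` the typed
riso-triviality dimension is `≥ 1`: on the chart `t₂ ≠ 0`,
`B[t₂⁻¹] = B₀[t₂, t₂⁻¹]` with `B₀ = k[t₃/t₁, t₃, t₁, t₀, t₀t₁, t₀t₁²/t₃]` free of `t₂`.
Chain of landed pieces: `Rtd B₀ m₀ 0` (identity straightener) ⟹ `Rtd B₀[t₂] m₁ 1`
(`rtd_adjoin_indeterminate`, `ta_transcendental_X2`) ⟹ `Rtd B₀[t₂][t₂⁻¹] _ 1` (`rtdLocal_iff`,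
upwards) = `Rtd B[t₂⁻¹] m₃ 1` (subalgebra identity, transported by generalising over the
subalgebra) ⟹ `Rtd B m 1` (`rtdLocal_iff`, downwards; `m₃ ∩ B = m` because `m` is maximal with
residue field `k` and `t₂ ∉ m`, `IsLocalization.algebraMap_mem_map_algebraMap_iff`).
Mathlib + tree only; no definitions, no named facts.
-/

set_option linter.dupNamespace false

noncomputable section

namespace Summit.ResolutionOfSingularities.ResolutionOfSingularities.Theorems

section ToricTCurve

variable {k K : Type} [Field k] [Field K] [Algebra k K]

/-- **Core of `toricT_curve_rtd_one`** over an abstract field `K ⊇ k(t₀,…,t₃)`-like datum: four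
nonzero `t i` with `t 2` transcendental over every subalgebra of `k[t₀, t₁, t₃][(t₁t₃)⁻¹]`, the
seven monomials `GK` of `T`, `B = k[GK]`, and a proper ideal `m` through the point `t₂ = c ≠ 0` of
the singular curve. Then typed `Rtd B m 1`: `B[t₂⁻¹] = B₀[t₂, t₂⁻¹]` with
`B₀ = k[t₃/t₁, t₃, t₁, t₀, t₀t₁, t₀t₁²/t₃]`; `Rtd B₀ _ 0` (identity straightener), the product
lemma `rtd_adjoin_indeterminate` gives `Rtd B₀[t₂] _ 1`, and `rtdLocal_iff` moves it up to
`B₀[t₂][t₂⁻¹] = B[t₂⁻¹]` and down to `B`. -/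
theorem toricT_curve_core (t : Fin 4 → K) (ht0 : ∀ i, t i ≠ 0)
    (htr : ∀ B₀ : Subalgebra k K, B₀ ≤ Algebra.adjoin k ({t 0, t 1, t 3, (t 1 * t 3)⁻¹} : Set K) →
      ∀ q : Polynomial ↥B₀, Polynomial.aeval (t 2) q = 0 → q = 0)
    (GK : Fin 7 → K)
    (hGK : GK = ![t 2 * t 3 * (t 1)⁻¹, t 3, t 2, t 1, t 0, t 0 * t 1 * (t 2)⁻¹,
      t 0 * t 1 ^ 2 * (t 2)⁻¹ * (t 3)⁻¹])
    (B : Subalgebra k K) (hB : B = Algebra.adjoin k (Set.range GK)) (c : k) (hc : c ≠ 0)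
    (m : Ideal ↥B) (hm : m ≠ ⊤)
    (hGm : ∀ b : ↥B, (b : K) ∈ ({GK 0, GK 1, GK 3, GK 4, GK 5, GK 6, GK 2 - algebraMap k K c} :
      Set K) → b ∈ m) :
    ∃ (n : ℕ) (g : Fin n → ↥B), (∀ i, g i ∈ m) ∧
      Algebra.adjoin k (Set.range fun i => (g i : K)) = B ∧
      ∃ W : Submodule k (Fin n → k), 1 ≤ Module.finrank k ↥W ∧
        ∃ φ : {α : ↥B →ₐ[k] HahnSeries ℚ k // ∀ b ∈ m, 0 < (α b).orderTop} →
            (Fin n → HahnSeries ℚ k),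
          (∀ a b : {α : ↥B →ₐ[k] HahnSeries ℚ k // ∀ b ∈ m, 0 < (α b).orderTop}, a ≠ b →
            ∃ j, ∀ i, (a.1 (g j) - b.1 (g j)).orderTop <
              ((φ a i - φ b i) - (a.1 (g i) - b.1 (g i))).orderTop) ∧
          (∀ a i, 0 < (φ a i).orderTop) ∧
          (∀ a, ∀ w : Fin n → HahnSeries ℚ k, (∀ i, 0 < (w i).orderTop) →
            w ∈ Submodule.span (HahnSeries ℚ k)
              ((fun u : Fin n → k => fun i => HahnSeries.C (u i)) '' (W : Set (Fin n → k))) →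
            ∃ b, φ b = φ a + w) := by
  -- (a) the seven monomials and the point `t₂ = c` of the singular curve
  have hG0 : GK 0 = t 2 * t 3 * (t 1)⁻¹ := by rw [hGK]; rfl
  have hG1 : GK 1 = t 3 := by rw [hGK]; rfl
  have hG2 : GK 2 = t 2 := by rw [hGK]; rfl
  have hG3 : GK 3 = t 1 := by rw [hGK]; rfl
  have hG4 : GK 4 = t 0 := by rw [hGK]; rfl
  have hG5 : GK 5 = t 0 * t 1 * (t 2)⁻¹ := by rw [hGK]; rfl
  have hG6 : GK 6 = t 0 * t 1 ^ 2 * (t 2)⁻¹ * (t 3)⁻¹ := by rw [hGK]; rfl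
  have hGKB : ∀ i, GK i ∈ B := fun i => hB ▸ Algebra.subset_adjoin ⟨i, rfl⟩
  have hBFG : B.FG := Subalgebra.fg_def.mpr ⟨Set.range GK, Set.finite_range GK, hB.symm⟩
  obtain ⟨G, hG⟩ : ∃ G : Fin 7 → ↥B, ∀ i, (G i : K) = GK i :=
    ⟨fun i => ⟨GK i, hGKB i⟩, fun i => rfl⟩
  have hGm' : ∀ i, i ≠ 2 → G i ∈ m := by
    intro i hi
    refine hGm _ ?_
    rw [hG]
    fin_cases i <;> first | exact absurd rfl hi | simp
  have hG2m : G 2 - algebraMap k ↥B c ∈ m := by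
    refine hGm _ ?_
    simp [hG, hG2]
  have hGgen : Algebra.adjoin k (Set.range G) = ⊤ := by
    refine adjoin_range_eq_top_of_adjoin_coe_eq B G ?_
    rw [show (fun i => (G i : K)) = GK from funext hG]
    exact hB.symm
  -- residue field `k` at `m`, so `m` is maximal and misses `t₂ ≡ c`
  have hres : ∀ x : ↥B, ∃ d : k, x - algebraMap k ↥B d ∈ m := by
    have hgen' :
        Algebra.adjoin k (Set.range (Function.update G 2 (G 2 - algebraMap k ↥B c))) = ⊤ := by
      rw [eq_top_iff, ← hGgen, Algebra.adjoin_le_iff]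
      rintro _ ⟨i, rfl⟩
      by_cases hi : i = 2
      · subst hi
        have h2 := add_mem (Algebra.subset_adjoin ⟨2, rfl⟩ :
          Function.update G 2 (G 2 - algebraMap k ↥B c) 2 ∈
            Algebra.adjoin k (Set.range (Function.update G 2 (G 2 - algebraMap k ↥B c))))
          (Subalgebra.algebraMap_mem _ c)
        rwa [Function.update_self, sub_add_cancel] at h2
      · exact Algebra.subset_adjoin ⟨i, Function.update_of_ne hi _ _⟩
    refine fin_residue m _ (fun i => ?_) hgen'
    by_cases hi : i = 2
    · subst hi
      rw [Function.update_self]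
      exact hG2m
    · rw [Function.update_of_ne hi]
      exact hGm' i hi
  have hmax : m.IsMaximal := by
    refine Ideal.isMaximal_iff.mpr ⟨fun h1 => hm ((Ideal.eq_top_iff_one m).mpr h1),
      fun J x hJ hxm hxJ => ?_⟩
    obtain ⟨d, hd⟩ := hres x
    have hd0 : d ≠ 0 := by
      rintro rfl
      exact hxm (by simpa using hd)
    have hdJ : algebraMap k ↥B d ∈ J := by simpa using J.sub_mem hxJ (hJ hd)
    exact (Ideal.eq_top_iff_one J).mp (J.eq_top_of_isUnit_mem hdJ ((IsUnit.mk0 d hd0).map _))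
  have hsB : t 2 ∈ B := hG2 ▸ hGKB 2
  have hsm : (⟨t 2, hsB⟩ : ↥B) ∉ m := fun h => by
    have h2 : G 2 ∈ m := by
      have h2' : G 2 = ⟨t 2, hsB⟩ := Subtype.ext (by rw [hG, hG2])
      rwa [h2']
    have hcm : algebraMap k ↥B c ∈ m := by simpa using m.sub_mem h2 hG2m
    exact hm (m.eq_top_of_isUnit_mem hcm ((IsUnit.mk0 c hc).map _))
  -- (b) the localisation `B₃ = B[t₂⁻¹]` and the extended ideal `m₃`
  have hle : B ≤ Algebra.adjoin k ((B : Set K) ∪ {(t 2)⁻¹}) := fun x hx =>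
    Algebra.subset_adjoin (Set.mem_union_left _ hx)
  letI instAlg := (Subalgebra.inclusion hle).toRingHom.toAlgebra
  haveI instLoc := arcEquiv_isLocalization (k := k) hsB (ht0 2) hle
  set m₃ : Ideal ↥(Algebra.adjoin k ((B : Set K) ∪ {(t 2)⁻¹})) := Ideal.map (algebraMap ↥B _) m
    with hm₃def
  have hcm' : ∀ x : ↥B, Subalgebra.inclusion hle x ∈ m₃ ↔ x ∈ m := fun x => by
    rw [hm₃def, show Subalgebra.inclusion hle x = algebraMap ↥B _ x from rfl,
      IsLocalization.algebraMap_mem_map_algebraMap_iff (Submonoid.powers (⟨t 2, hsB⟩ : ↥B))]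
    constructor
    · rintro ⟨_, ⟨e, rfl⟩, h⟩
      exact (hmax.isPrime.mem_or_mem h).resolve_left fun h' =>
        hsm (hmax.isPrime.mem_of_pow_mem e h')
    · exact fun h => ⟨1, Submonoid.one_mem _, by rwa [one_mul]⟩
  have hm₃ : m₃ ≠ ⊤ := fun h =>
    hsm ((hcm' ⟨t 2, hsB⟩).mp (by rw [h]; exact Submodule.mem_top))
  have hcomap : m₃.comap (Subalgebra.inclusion hle) = m := Ideal.ext hcm'
  have hmem₃ : ∀ b : ↥B, b ∈ m → ∀ z y : ↥(Algebra.adjoin k ((B : Set K) ∪ {(t 2)⁻¹})),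
      (z : K) = (b : K) * (y : K) → z ∈ m₃ := by
    intro b hb z y hz
    have hz' : z = algebraMap ↥B _ b * y := Subtype.ext (by rw [hz]; rfl)
    rw [hz']
    exact m₃.mul_mem_right y (Ideal.mem_map_of_mem _ hb)
  -- (c) the product chart `B₀ = k[t₃/t₁, t₃, t₁, t₀, t₀t₁, t₀t₁²/t₃]`, `B₁ = B₀[t₂]`,
  -- `B₃' = B₁[t₂⁻¹]`
  set g₀K : Fin 6 → K := ![t 3 * (t 1)⁻¹, t 3, t 1, t 0, t 0 * t 1, t 0 * t 1 ^ 2 * (t 3)⁻¹]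
  obtain ⟨B₀, hB₀⟩ : ∃ B₀ : Subalgebra k K, B₀ = Algebra.adjoin k (Set.range g₀K) := ⟨_, rfl⟩
  have hg₀B₀ : ∀ i, g₀K i ∈ B₀ := fun i => hB₀ ▸ Algebra.subset_adjoin ⟨i, rfl⟩
  have hB₀A : B₀ ≤ Algebra.adjoin k ({t 0, t 1, t 3, (t 1 * t 3)⁻¹} : Set K) := by
    have hA : ∀ x ∈ ({t 0, t 1, t 3, (t 1 * t 3)⁻¹} : Set K),
        x ∈ Algebra.adjoin k ({t 0, t 1, t 3, (t 1 * t 3)⁻¹} : Set K) := fun x hx =>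
      Algebra.subset_adjoin hx
    have h0 := hA (t 0) (by simp)
    have h1 := hA (t 1) (by simp)
    have h3 := hA (t 3) (by simp)
    have h1i : (t 1)⁻¹ ∈ Algebra.adjoin k ({t 0, t 1, t 3, (t 1 * t 3)⁻¹} : Set K) := by
      rw [show (t 1)⁻¹ = t 3 * (t 1 * t 3)⁻¹ by
        rw [mul_inv, mul_comm (t 1)⁻¹, mul_inv_cancel_left₀ (ht0 3)]]
      exact mul_mem h3 (hA _ (by simp))
    have h3i : (t 3)⁻¹ ∈ Algebra.adjoin k ({t 0, t 1, t 3, (t 1 * t 3)⁻¹} : Set K) := by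
      rw [show (t 3)⁻¹ = t 1 * (t 1 * t 3)⁻¹ by rw [mul_inv, mul_inv_cancel_left₀ (ht0 1)]]
      exact mul_mem h1 (hA _ (by simp))
    rw [hB₀, Algebra.adjoin_le_iff, Set.range_subset_iff]
    intro i
    fin_cases i
    · exact mul_mem h3 h1i
    · exact h3
    · exact h1
    · exact h0
    · exact mul_mem h0 h1
    · exact mul_mem (mul_mem h0 (pow_mem h1 2)) h3i
  have hle₀ : B₀ ≤ Algebra.adjoin k ((B₀ : Set K) ∪ {t 2}) := fun x hx =>
    Algebra.subset_adjoin (Set.mem_union_left _ hx)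
  set B₁ := Algebra.adjoin k ((B₀ : Set K) ∪ {t 2}) with hB₁
  have ht2B₁ : t 2 ∈ B₁ := Algebra.subset_adjoin (Set.mem_union_right _ rfl)
  have hle₁ : B₁ ≤ Algebra.adjoin k ((B₁ : Set K) ∪ {(t 2)⁻¹}) := fun x hx =>
    Algebra.subset_adjoin (Set.mem_union_left _ hx)
  set B₃' := Algebra.adjoin k ((B₁ : Set K) ∪ {(t 2)⁻¹}) with hB₃'
  have ht2B₃' : t 2 ∈ B₃' := hle₁ ht2B₁
  have ht2iB₃' : (t 2)⁻¹ ∈ B₃' := Algebra.subset_adjoin (Set.mem_union_right _ rfl)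
  have hg₀B₃' : ∀ i, g₀K i ∈ B₃' := fun i => hle₁ (hle₀ (hg₀B₀ i))
  have hB₁FG : B₁.FG := by
    rw [hB₁, Set.union_singleton, hB₀, Algebra.adjoin_insert_adjoin]
    exact Subalgebra.fg_def.mpr ⟨_, (Set.finite_range g₀K).insert (t 2), rfl⟩
  -- the identity `B[t₂⁻¹] = B₁[t₂⁻¹]`
  have ht2B₃ : t 2 ∈ Algebra.adjoin k ((B : Set K) ∪ {(t 2)⁻¹}) := hle hsB
  have ht2iB₃ : (t 2)⁻¹ ∈ Algebra.adjoin k ((B : Set K) ∪ {(t 2)⁻¹}) :=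
    Algebra.subset_adjoin (Set.mem_union_right _ rfl)
  have hGKB₃ : ∀ i, GK i ∈ Algebra.adjoin k ((B : Set K) ∪ {(t 2)⁻¹}) := fun i => hle (hGKB i)
  have r0 : t 3 * (t 1)⁻¹ * t 2 = GK 0 := by rw [hG0]; ring
  have r4 : GK 5 * t 2 = t 0 * t 1 := by rw [hG5, inv_mul_cancel_right₀ (ht0 2)]
  have r5 : GK 6 * t 2 = t 0 * t 1 ^ 2 * (t 3)⁻¹ := by
    rw [hG6, mul_right_comm _ (t 2)⁻¹, inv_mul_cancel_right₀ (ht0 2)]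
  have hB₃eq : Algebra.adjoin k ((B : Set K) ∪ {(t 2)⁻¹}) = B₃' := by
    apply le_antisymm
    · rw [Algebra.adjoin_le_iff]
      rintro x (hx | hx)
      · rw [SetLike.mem_coe, hB] at hx
        refine (Algebra.adjoin_le_iff.mpr ?_ : Algebra.adjoin k (Set.range GK) ≤ B₃') hx
        rintro _ ⟨j, rfl⟩
        fin_cases j
        · show GK 0 ∈ B₃'
          rw [← r0]
          exact mul_mem (hg₀B₃' 0) ht2B₃'
        · show GK 1 ∈ B₃'
          exact hG1 ▸ hg₀B₃' 1
        · show GK 2 ∈ B₃'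
          exact hG2 ▸ ht2B₃'
        · show GK 3 ∈ B₃'
          exact hG3 ▸ hg₀B₃' 2
        · show GK 4 ∈ B₃'
          exact hG4 ▸ hg₀B₃' 3
        · show GK 5 ∈ B₃'
          rw [(eq_mul_inv_iff_mul_eq₀ (ht0 2)).mpr r4]
          exact mul_mem (hg₀B₃' 4) ht2iB₃'
        · show GK 6 ∈ B₃'
          rw [(eq_mul_inv_iff_mul_eq₀ (ht0 2)).mpr r5]
          exact mul_mem (hg₀B₃' 5) ht2iB₃'
      · rw [Set.mem_singleton_iff] at hx
        rw [hx]
        exact ht2iB₃'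
    · refine Algebra.adjoin_le_iff.mpr ?_
      rintro x (hx | hx)
      · refine (Algebra.adjoin_le_iff.mpr ?_ : B₁ ≤ _) hx
        rintro y (hy | hy)
        · rw [SetLike.mem_coe, hB₀] at hy
          refine (Algebra.adjoin_le_iff.mpr ?_ : Algebra.adjoin k (Set.range g₀K) ≤ _) hy
          rintro _ ⟨i, rfl⟩
          fin_cases i
          · show t 3 * (t 1)⁻¹ ∈ Algebra.adjoin k ((B : Set K) ∪ {(t 2)⁻¹})
            rw [(eq_mul_inv_iff_mul_eq₀ (ht0 2)).mpr r0]
            exact mul_mem (hGKB₃ 0) ht2iB₃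
          · show t 3 ∈ Algebra.adjoin k ((B : Set K) ∪ {(t 2)⁻¹})
            exact hG1 ▸ hGKB₃ 1
          · show t 1 ∈ Algebra.adjoin k ((B : Set K) ∪ {(t 2)⁻¹})
            exact hG3 ▸ hGKB₃ 3
          · show t 0 ∈ Algebra.adjoin k ((B : Set K) ∪ {(t 2)⁻¹})
            exact hG4 ▸ hGKB₃ 4
          · show t 0 * t 1 ∈ Algebra.adjoin k ((B : Set K) ∪ {(t 2)⁻¹})
            rw [← r4]
            exact mul_mem (hGKB₃ 5) ht2B₃
          · show t 0 * t 1 ^ 2 * (t 3)⁻¹ ∈ Algebra.adjoin k ((B : Set K) ∪ {(t 2)⁻¹})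
            rw [← r5]
            exact mul_mem (hGKB₃ 6) ht2B₃
        · rw [Set.mem_singleton_iff] at hy
          rw [hy]
          exact ht2B₃
      · rw [Set.mem_singleton_iff] at hx
        rw [hx]
        exact ht2iB₃
  -- (d)+(e) typed `Rtd Y mY 1` for every copy `Y` of `B₁[t₂⁻¹]` and ideal `mY` at the point
  have H : ∀ (Y : Subalgebra k K), Y = B₃' → ∀ (mY : Ideal ↥Y), mY ≠ ⊤ →
      (∀ b : ↥B, b ∈ m → ∀ z y : ↥Y, (z : K) = (b : K) * (y : K) → z ∈ mY) →
      ∃ (n : ℕ) (g : Fin n → ↥Y), (∀ i, g i ∈ mY) ∧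
        Algebra.adjoin k (Set.range fun i => (g i : K)) = Y ∧
        ∃ W : Submodule k (Fin n → k), 1 ≤ Module.finrank k ↥W ∧
          ∃ φ : {α : ↥Y →ₐ[k] HahnSeries ℚ k // ∀ b ∈ mY, 0 < (α b).orderTop} →
              (Fin n → HahnSeries ℚ k),
            (∀ a b : {α : ↥Y →ₐ[k] HahnSeries ℚ k // ∀ b ∈ mY, 0 < (α b).orderTop}, a ≠ b →
              ∃ j, ∀ i, (a.1 (g j) - b.1 (g j)).orderTop <
                ((φ a i - φ b i) - (a.1 (g i) - b.1 (g i))).orderTop) ∧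
            (∀ a i, 0 < (φ a i).orderTop) ∧
            (∀ a, ∀ w : Fin n → HahnSeries ℚ k, (∀ i, 0 < (w i).orderTop) →
              w ∈ Submodule.span (HahnSeries ℚ k)
                ((fun u : Fin n → k => fun i => HahnSeries.C (u i)) '' (W : Set (Fin n → k))) →
              ∃ b, φ b = φ a + w) := by
    intro Y hY mY hmY hmem
    subst hY
    -- the presentation of `B₀` by the six monomials, inside `m₀ := mY ∩ B₀`
    obtain ⟨g₀, hg₀⟩ : ∃ g₀ : Fin 6 → ↥B₀, ∀ i, (g₀ i : K) = g₀K i :=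
      ⟨fun i => ⟨g₀K i, hg₀B₀ i⟩, fun i => rfl⟩
    have hg₀gen : Algebra.adjoin k (Set.range fun i => (g₀ i : K)) = B₀ := by
      rw [show (fun i => (g₀ i : K)) = g₀K from funext hg₀, hB₀]
    set m₁ : Ideal ↥B₁ := mY.comap (Subalgebra.inclusion hle₁) with hm₁
    set m₀ : Ideal ↥B₀ := m₁.comap (Subalgebra.inclusion hle₀) with hm₀
    have tab : ∀ i : Fin 6, ∃ j : Fin 7, j ≠ 2 ∧ ∃ y ∈ B₃', g₀K i = GK j * y := by
      intro i
      fin_cases i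
      · exact ⟨0, by decide, _, ht2iB₃', (eq_mul_inv_iff_mul_eq₀ (ht0 2)).mpr r0⟩
      · exact ⟨1, by decide, 1, one_mem _, by rw [mul_one, hG1]; rfl⟩
      · exact ⟨3, by decide, 1, one_mem _, by rw [mul_one, hG3]; rfl⟩
      · exact ⟨4, by decide, 1, one_mem _, by rw [mul_one, hG4]; rfl⟩
      · exact ⟨5, by decide, _, ht2B₃', r4.symm⟩
      · exact ⟨6, by decide, _, ht2B₃', r5.symm⟩
    have hg₀m : ∀ i, g₀ i ∈ m₀ := by
      intro i
      obtain ⟨j, hj, y, hy, hval⟩ := tab i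
      show Subalgebra.inclusion hle₁ (Subalgebra.inclusion hle₀ (g₀ i)) ∈ mY
      refine hmem (G j) (hGm' j hj) _ ⟨y, hy⟩ ?_
      rw [Subalgebra.coe_inclusion, Subalgebra.coe_inclusion, hg₀, hval, hG]
    have hU' : (⟨t 2, ht2B₁⟩ : ↥B₁) - algebraMap k ↥B₁ c ∈ m₁ := by
      show Subalgebra.inclusion hle₁ ((⟨t 2, ht2B₁⟩ : ↥B₁) - algebraMap k ↥B₁ c) ∈ mY
      refine hmem (G 2 - algebraMap k ↥B c) hG2m _ 1 ?_
      simp only [map_sub, AlgHom.commutes, Subalgebra.coe_sub, Subalgebra.coe_inclusion,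
        Subalgebra.coe_algebraMap, hG, hG2, OneMemClass.coe_one, mul_one]
    -- the `r = 0` base for `B₀` at `m₀`: identity straightener, `W = ⊥`
    have base : ∃ (n : ℕ) (g : Fin n → ↥B₀), (∀ i, g i ∈ m₀) ∧
        Algebra.adjoin k (Set.range fun i => (g i : K)) = B₀ ∧
        ∃ W : Submodule k (Fin n → k), 0 ≤ Module.finrank k ↥W ∧
          ∃ φ : {α : ↥B₀ →ₐ[k] HahnSeries ℚ k // ∀ x ∈ m₀, 0 < (α x).orderTop} →
              (Fin n → HahnSeries ℚ k),
            (∀ a b : {α : ↥B₀ →ₐ[k] HahnSeries ℚ k // ∀ x ∈ m₀, 0 < (α x).orderTop}, a ≠ b →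
              ∃ j, ∀ i, (a.1 (g j) - b.1 (g j)).orderTop <
                ((φ a i - φ b i) - (a.1 (g i) - b.1 (g i))).orderTop) ∧
            (∀ a i, 0 < (φ a i).orderTop) ∧
            (∀ a, ∀ w : Fin n → HahnSeries ℚ k, (∀ i, 0 < (w i).orderTop) →
              w ∈ Submodule.span (HahnSeries ℚ k)
                ((fun u : Fin n → k => fun i => HahnSeries.C (u i)) '' (W : Set (Fin n → k))) →
              ∃ b, φ b = φ a + w) := by
      refine ⟨6, g₀, hg₀m, hg₀gen, ⊥, Nat.zero_le _, fun a i => a.1 (g₀ i), ?_,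
        fun a i => a.2 _ (hg₀m i), ?_⟩
      · intro a b hab
        have hex : ∃ j, a.1 (g₀ j) ≠ b.1 (g₀ j) := by
          by_contra hcon
          push Not at hcon
          exact hab (Subtype.ext (AlgHom.ext_of_adjoin_eq_top
            (adjoin_range_eq_top_of_adjoin_coe_eq B₀ g₀ hg₀gen)
            (by rintro _ ⟨j, rfl⟩; exact hcon j)))
        obtain ⟨j, hj⟩ := hex
        refine ⟨j, fun i => ?_⟩
        rw [sub_self, HahnSeries.orderTop_zero]
        exact HahnSeries.orderTop_lt_top.mpr (sub_ne_zero.mpr hj)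
      · intro a w _ hw
        refine ⟨a, ?_⟩
        have hw0 : w = 0 := by
          rw [Submodule.bot_coe, Set.image_singleton] at hw
          have h0 : (fun i : Fin 6 => HahnSeries.C ((0 : Fin 6 → k) i)) =
              (0 : Fin 6 → HahnSeries ℚ k) := by
            funext i
            simp
          rw [h0, Submodule.span_zero_singleton, Submodule.mem_bot] at hw
          exact hw
        rw [hw0, add_zero]
    have h₁ := rtd_adjoin_indeterminate B₀ m₀ (t 2) c (htr B₀ hB₀A) hle₀ m₁ ⟨t 2, ht2B₁⟩
      rfl (fun b => Iff.rfl) hU' 0 base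
    exact (rtdLocal_iff B₁ (t 2) ht2B₁ (ht0 2) hB₁FG hle₁ mY hmY 1).mpr h₁
  -- (f) assembly: `Rtd B₃ m₃ 1`, then down to `B` along the localisation
  have h₃ := H _ hB₃eq m₃ hm₃ hmem₃
  have h₄ := (rtdLocal_iff B (t 2) hsB (ht0 2) hBFG hle m₃ hm₃ 1).mp h₃
  rw [hcomap] at h₄
  exact h₄

end ToricTCurve

/-- **Typed `rtd = 1` along the singular curves of the toric fourfold `T`** (lead c2, stub
`toricT_curve_rtd_one` of crux `RisoCentresResolve`, line `Sketch`). `K = k(t₀,…,t₃)`, `GK` the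
seven monomials `t₂t₃/t₁, t₃, t₂, t₁, t₀, t₀t₁/t₂, t₀t₁²/(t₂t₃)` generating `B = k[S_T]`, and `m` a
proper ideal of `B` through the point `t₂ = c ≠ 0` of the singular curve `C₃` (closure of the orbit
on which only the powers of `t₂` survive). Then the route's inline `Rtd B m 1` HOLDS: on the chart
`t₂ ≠ 0`, `B[t₂⁻¹] = B₀[t₂, t₂⁻¹]` is a genuine product. With `toricT_vertex_not_rtd_one` this
shows that the letter `0` separates the vertex of `T` from its singular curves. Any field `k`. -/
theorem toricT_curve_rtd_one : ∀ (k : Type) [Field k] (t : Fin 4 → FractionRing (MvPolynomial (Fin 4) k)), (∀ i, t i = algebraMap (MvPolynomial (Fin 4) k) (FractionRing (MvPolynomial (Fin 4) k)) (MvPolynomial.X i)) → ∀ (GK : Fin 7 → FractionRing (MvPolynomial (Fin 4) k)), GK = ![t 2 * t 3 * (t 1)⁻¹, t 3, t 2, t 1, t 0, t 0 * t 1 * (t 2)⁻¹, t 0 * t 1 ^ 2 * (t 2)⁻¹ * (t 3)⁻¹] → ∀ (B : Subalgebra k (FractionRing (MvPolynomial (Fin 4) k))), B = Algebra.adjoin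 k (Set.range GK) → ∀ (c : k), c ≠ 0 → ∀ (m : Ideal ↥B), m ≠ ⊤ → (∀ b : ↥B, (b : FractionRing (MvPolynomial (Fin 4) k)) ∈ ({GK 0, GK 1, GK 3, GK 4, GK 5, GK 6, GK 2 - algebraMap k (FractionRing (MvPolynomial (Fin 4) k)) c} : Set (FractionRing (MvPolynomial (Fin 4) k))) → b ∈ m) → ∃ (n : ℕ) (g : Fin n → ↥B), (∀ i, g i ∈ m) ∧ Algebra.adjoin k (Set.range fun i => (g i : FractionRing (MvPolynomial (Fin 4) k))) = B ∧ ∃ W : Submodule k (Fin n → k), 1 ≤ Module.finrank k ↥W ∧ ∃ φ : {α : ↥B →ₐ[k] HahnSeries ℚ k // ∀ b ∈ m, 0 < (α b).orderTop} → (Fin n → HahnSeries ℚ k), (∀ a b : {α : ↥B →ₐ[k] HahnSeries ℚ k // ∀ b ∈ m, 0 < (α b).orderTop}, a ≠ b → ∃ j, ∀ i, (a.1 (g j) - b.1 (g j)).orderTop < ((φ a i - φ b i) - (a.1 (g i) - b.1 (g i))).orderTop) ∧ (∀ a i, 0 < (φ a i).orderTop) ∧ (∀ a, ∀ w : Fin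 n → HahnSeries ℚ k, (∀ i, 0 < (w i).orderTop) → w ∈ Submodule.span (HahnSeries ℚ k) ((fun u : Fin n → k => fun i => HahnSeries.C (u i)) '' (W : Set (Fin n → k))) → ∃ b, φ b = φ a + w) := by
  intro k _ t ht
  have ht0 : ∀ i, t i ≠ 0 := fun i => by
    rw [ht i]
    exact (map_ne_zero_iff _ (IsFractionRing.injective (MvPolynomial (Fin 4) k)
      (FractionRing (MvPolynomial (Fin 4) k)))).mpr (MvPolynomial.X_ne_zero _)
  exact toricT_curve_core t ht0 (ta_transcendental_X2 k t ht)

end Summit.ResolutionOfSingularities.ResolutionOfSingularities.Theorems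

end
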